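import Summits.AtomisticToContinuum.HydrodynamicLimit.Theses.TwoClocks

/-!
# Sketch — crux-ideate round 2, ideator 5, crux stmt-AtomisticToContinuum-16624 `TwoClocks.TransferActivityTails`

First lemmas (typed, elaborating; nothing asserted) of the two idea cards

* `predictor-drift-doob`   : `BlockAct`, `PredictorDrift`, `OneBlockUI`, `DriftLLNEngine`;
* `heavy-block-pattern-cost`: `HeavyBlockPatternCost`, `PatternCostEngine`.

Both cards cut the crux's window `(s, s + τ(N+1)^{-1/3}]` into `K` consecutive blocks of `τ₁(N+1)^{-1/3}`
(`τ = Kτ₁`), so that the window activity is the AVERAGE of the block activities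
(`a_i = K⁻¹ Σ_{j<K} X_{i,j}`, an identity of `collisionSum` over a partition of the window on the good set),
and posit a ONE-PARTICLE TEMPORAL NON-CLUSTERING property of the block sequence under the crux's own law
(`localGibbsLaw` at time `0`, blocks along the true orbit) from which the crux's fixed-level `L¹` tail follows
by an ABSTRACT probability engine with an explicit threshold `V₀` and a rate in `K`:
* card 1: a Foster–Lyapunov DRIFT of the one-step predictor, `E[X_{j+1} | X_0,…,X_j] ≤ ρ·(average of the last L
  blocks) + C`, in its integrated form against `[0,1]`-valued test functionals of the history (no conditional
  expectation in the statement), plus one-block uniform integrability; engine = Doob decomposition + orthogonality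
  of bounded martingale increments + Markov (`DriftLLNEngine`);
* card 2: an exponential COST per heavy block, `P(X_j > y₀2^m ∀ j ∈ S) ≤ exp(−(c₀ + 2m)|S|)` for every finite
  set `S` of block indices (dyadic levels), plus one-block UI; engine = layer cake + binomial pattern counting
  (`PatternCostEngine`).
The engines are pure measure theory (to be PROVED in crux-plan; stated here as `Prop`s so that the file is
sorry-free).  `lintegral ∘ ENNReal.ofReal` throughout (no Bochner junk values).
-/

noncomputable section

open MeasureTheory Filter Set Topology
open scoped ENNReal BigOperators

namespace Summit.AtomisticToContinuum.HydrodynamicLimit.Cruxes.TransferActivityTails.IdeatorFive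

open Literature.MathematicalPhysics.KineticTheory Literature.Analysis.FluidPDE

/-- A hard-sphere flow of `N + 1` spheres of reduced diameter `σ` on `𝕋³` (the crux's `Φ N`). -/
abbrev Flow (σ : ℝ) (N : ℕ) : Type :=
  HardSphereFlow (Torus.geometry (Fin 3)) (hsDiameter σ N) (N + 1)

/-- Phase space of `N + 1` spheres. -/
abbrev Cfg (N : ℕ) : Type := Config (N + 1) (Fin 3) T3

/-- Microscopic length of a block of `τ₁` kinetic units: `τ₁ (N+1)^{-1/3}`. -/
def blockLen (τ₁ : ℝ) (N : ℕ) : ℝ := τ₁ * ((N : ℝ) + 1) ^ (-(1 / 3 : ℝ))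

/-- **Block transfer activity** `X_{i,j}(s)`: the crux's transfer activity of particle `i` restricted to the
`j`-th block `(s + j·ℓ, s + (j+1)·ℓ]`, `ℓ = blockLen τ₁ N`, normalised per block (prefactor `σ/τ₁`), so that for
`τ = K τ₁` the crux's window activity is `a_i(s) = K⁻¹ Σ_{j<K} X_{i,j}(s)` on the good set. -/
def BlockAct (σ τ₁ : ℝ) {N : ℕ} (Φ : Flow σ N) (i : Fin (N + 1)) (j : ℕ) (s : ℝ) (z : Cfg N) : ℝ :=
  σ / τ₁ * Φ.collisionSum (Set.Ioc (s + j * blockLen τ₁ N) (s + (j + 1) * blockLen τ₁ N))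
    (fun c => if c.fst = i then ‖c.postVel.1 - c.preVel.1‖ + |‖c.postVel.1‖ ^ 2 - ‖c.preVel.1‖ ^ 2| / 2 else 0) z

/-- The crux's frame (its quantifier prefix up to `∀ t ∈ Ico 0 T`), abstracted over the conclusion `Q σ t Φ P`
(`P` = the local Gibbs law at time `0`; blocks are read along the true orbit, exactly as in the crux). -/
def InCruxFrame (Q : (σ : ℝ) → (t : ℝ) → ((N : ℕ) → Flow σ N) → ((N : ℕ) → Measure (Cfg N)) → Prop) : Prop :=
  ∀ (a₀ θ₀ : T3 → ℝ) (u₀ : T3 → V3), Continuous a₀ → Continuous θ₀ → Continuous u₀ →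
    (∀ x, 0 < a₀ x) → (∀ x, 0 < θ₀ x) → ∃ σ₀ : ℝ, 0 < σ₀ ∧ ∀ σ : ℝ, 0 < σ → σ < σ₀ →
    ∀ (T : ℝ) (ρ θ : ℝ → T3 → ℝ) (u : ℝ → T3 → V3), IsHardSphereEulerSolution σ T ρ u θ →
    ∀ Φ : (N : ℕ) → Flow σ N,
    TendstoHydroFieldsAt (fun N => localGibbsLaw σ a₀ u₀ θ₀ N (Φ N)) Φ ρ u θ 0 →
    ∀ t ∈ Set.Ico 0 T, Q σ t Φ (fun N => localGibbsLaw σ a₀ u₀ θ₀ N (Φ N))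

/-! ## Card 1 — `predictor-drift-doob` -/

/-- **(CD) Predictor drift along the tagged particle's own block-activity history** (integrated form).
Block length `τ₁`, contraction `ρ < 1`, constant `C`, history window `L`: for every number of blocks `K`, all
large `N`, every start `s ≤ t`, every particle `i`, every block index `j` with a full history window behind it
and `j + 1 < K`, and every measurable `[0,1]`-valued functional `g` of the history `(X_{i,0},…,X_{i,j})`:
`∫ X_{i,j+1} · g(hist) dP ≤ ∫ (ρ · L⁻¹ Σ_{k=j+1-L}^{j} X_{i,k} + C) · g(hist) dP`.
Equivalent to `E_P[X_{i,j+1} | σ(X_{i,0..j})] ≤ ρ·H_{i,j} + C` a.s.; "hyperactivity is not self-sustaining in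
conditional mean, one block ahead, given the particle's own coarse past". -/
def PredictorDrift (τ₁ ρ C : ℝ) (L : ℕ) : Prop :=
  InCruxFrame fun σ t Φ P =>
    ∀ K : ℕ, 1 ≤ K → ∃ N₀ : ℕ, ∀ N : ℕ, N₀ ≤ N → ∀ s ∈ Set.Icc 0 t, ∀ i : Fin (N + 1),
    ∀ j : ℕ, L ≤ j + 1 → j + 1 < K →
    ∀ g : (Fin (j + 1) → ℝ) → ℝ, Measurable g → (∀ y, 0 ≤ g y ∧ g y ≤ 1) →
      ∫⁻ z, ENNReal.ofReal (BlockAct σ τ₁ (Φ N) i (j + 1) s z *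
          g (fun k => BlockAct σ τ₁ (Φ N) i k s z)) ∂(P N) ≤
      ∫⁻ z, ENNReal.ofReal ((ρ * ((L : ℝ)⁻¹ * ∑ k ∈ Finset.range L, BlockAct σ τ₁ (Φ N) i (j + 1 - L + k) s z) + C) *
          g (fun k => BlockAct σ τ₁ (Φ N) i k s z)) ∂(P N)

/-- **(UI₁) One-block uniform integrability under the true law** (UI-shape: the level `M` is chosen AFTER the
accuracy `δ`; averaged over particles, as in the crux). -/
def OneBlockUI (τ₁ : ℝ) : Prop :=
  InCruxFrame fun σ t Φ P =>
    ∀ δ : ℝ, 0 < δ → ∃ M : ℝ, 0 ≤ M ∧ ∀ K : ℕ, 1 ≤ K → ∃ N₀ : ℕ, ∀ N : ℕ, N₀ ≤ N →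
    ∀ s ∈ Set.Icc 0 t, ∀ j : ℕ, j < K →
      ∫⁻ z, ENNReal.ofReal (((N : ℝ) + 1)⁻¹ * ∑ i : Fin (N + 1), max (BlockAct σ τ₁ (Φ N) i j s z - M) 0)
        ∂(P N) ≤ ENNReal.ofReal δ

/-- **Drift ⇒ LLN engine** (abstract probability; the card's composition lemma, to be proved in crux-plan).
Nonnegative measurable `X₀,…,X_{K-1}` on a probability space; integrated drift with `(ρ, C, L)` for the blocks
that have a full history window; truncation level `M` with overshoot `≤ δ` in mean, a second level `M'` with
overshoot `≤ δ'`, and mean `≤ m` for the first `L` blocks.  Then, with `V₀ := 4(C+1)/(1-ρ)` and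
`ā := K⁻¹ Σ_{j<K} X_j`,  `E[ā·𝟙{ā > V₀}] ≤ M'·(2δ + (9M² + 6Lm)/(4K)) + δ'`.
Proof sketch: `Y = X ∧ M`, Doob decomposition of `Σ Y_j` along `σ(X_{≤ j})`, increments bounded by `M` hence
orthogonal with `E[(Σ D_j)²] ≤ KM²` (Chebyshev), drift absorbs `Σ E[Y_j | past] ≤ ρKā + CK`, Markov for the two
overshoots and for the first `L` blocks. -/
def DriftLLNEngine : Prop :=
  ∀ (Ω : Type) [MeasurableSpace Ω] (P : Measure Ω) [IsProbabilityMeasure P] (K L : ℕ) (X : ℕ → Ω → ℝ)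
    (ρ C M δ M' δ' m : ℝ),
    (∀ j, Measurable (X j)) → (∀ j ω, 0 ≤ X j ω) → 0 ≤ ρ → ρ < 1 → 0 ≤ C → 1 ≤ L → L < K →
    0 ≤ M → 0 ≤ δ → 0 ≤ M' → 0 ≤ δ' → 0 ≤ m →
    (∀ j : ℕ, L ≤ j + 1 → j + 1 < K → ∀ g : (Fin (j + 1) → ℝ) → ℝ, Measurable g → (∀ y, 0 ≤ g y ∧ g y ≤ 1) →
      ∫⁻ ω, ENNReal.ofReal (X (j + 1) ω * g (fun k => X k ω)) ∂P ≤
      ∫⁻ ω, ENNReal.ofReal ((ρ * ((L : ℝ)⁻¹ * ∑ k ∈ Finset.range L, X (j + 1 - L + k) ω) + C) *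
        g (fun k => X k ω)) ∂P) →
    (∀ j, j < K → ∫⁻ ω, ENNReal.ofReal (max (X j ω - M) 0) ∂P ≤ ENNReal.ofReal δ) →
    (∀ j, j < K → ∫⁻ ω, ENNReal.ofReal (max (X j ω - M') 0) ∂P ≤ ENNReal.ofReal δ') →
    (∀ j, j < L → ∫⁻ ω, ENNReal.ofReal (X j ω) ∂P ≤ ENNReal.ofReal m) →
    ∫⁻ ω, ENNReal.ofReal (Set.indicator {y : ℝ | 4 * (C + 1) / (1 - ρ) < y} (fun y => y)
        ((K : ℝ)⁻¹ * ∑ j ∈ Finset.range K, X j ω)) ∂P ≤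
      ENNReal.ofReal (M' * (2 * δ + (9 * M ^ 2 + 6 * L * m) / (4 * K)) + δ')

/-- **Card 1's transfer**: `C⁺ := ∃ τ₁ ρ C L, PredictorDrift ∧ OneBlockUI` (plus the engine and the block
identity) `⟹` the crux.  Typed as the implication the crux-plan skeleton would conclude BY NAME. -/
def DriftTransfer : Prop :=
  DriftLLNEngine →
  (∃ τ₁ ρ C : ℝ, ∃ L : ℕ, 0 < τ₁ ∧ 0 ≤ ρ ∧ ρ < 1 ∧ 0 ≤ C ∧ 1 ≤ L ∧ PredictorDrift τ₁ ρ C L ∧ OneBlockUI τ₁) →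
    Summit.AtomisticToContinuum.HydrodynamicLimit.Theses.TwoClocks.TransferActivityTails

/-! ## Card 2 — `heavy-block-pattern-cost` -/

/-- **(PC) Exponential cost per heavy block, uniformly over temporal patterns** (dyadic levels): block length
`τ₁`, base level `y₀`, base cost `c₀ ≥ 3` nats; for every `K`, all large `N`, every start `s ≤ t`, particle
`i`, dyadic exponent `m` and every nonempty set `S` of block indices `< K`:
`P(X_{i,j}(s) > y₀ 2^m for all j ∈ S) ≤ exp(−(c₀ + 2m)·|S|)`.
"`τ` in the exponent lives in the NUMBER of heavy blocks of one particle, never in the activity": an LD upper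
bound in indicator currency for one particle's space-time pattern, untouched by the cradle refutation. -/
def HeavyBlockPatternCost (τ₁ y₀ c₀ : ℝ) : Prop :=
  InCruxFrame fun σ t Φ P =>
    ∀ K : ℕ, 1 ≤ K → ∃ N₀ : ℕ, ∀ N : ℕ, N₀ ≤ N → ∀ s ∈ Set.Icc 0 t, ∀ i : Fin (N + 1),
    ∀ m : ℕ, ∀ S : Finset (Fin K), S.Nonempty →
      (P N) {z | ∀ j ∈ S, y₀ * 2 ^ m < BlockAct σ τ₁ (Φ N) i j s z} ≤
        ENNReal.ofReal (Real.exp (-((c₀ + 2 * m) * S.card)))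

/-- **Pattern-cost ⇒ LLN engine** (abstract probability; card 2's composition lemma, to be proved in crux-plan):
for every base cost `c₀ ≥ 3` and accuracy `η > 0` there is `K₀`, depending on `(c₀, η)` ONLY, such that for all
`K ≥ K₀` and every nonnegative measurable `X₀,…,X_{K-1}` on a probability space satisfying the dyadic pattern
bound with `(y₀, c₀)` and an overshoot bound `E[(X_j − M')₊] ≤ δ'`, the window average
`ā = K⁻¹ΣX_j` has `E[ā·𝟙{ā > 8y₀}] ≤ M'η + δ'`.
Proof sketch: layer cake `ā ≤ y₀ + Σ_m y₀2^{m+1} f_m` (`f_m` = fraction of blocks above `y₀2^m`); if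
`f_m ≤ 1.75·4^{-m}` for all `m` then `ā ≤ 8y₀`; `P(f_m > θ_m) ≤ C(K,n)·e^{-(c₀+2m)n} ≤ e^{-n(c₀ − 0.44 + 0.61m)}`
with `n = ⌊θ_m K⌋ + 1`, summable in `m` to `≤ c·K^{-0.44}`; then `E[ā; bad] ≤ M'·P(bad) + δ'`. -/
def PatternCostEngine : Prop :=
  ∀ c₀ η : ℝ, 3 ≤ c₀ → 0 < η → ∃ K₀ : ℕ, ∀ K : ℕ, K₀ ≤ K →
    ∀ (Ω : Type) [MeasurableSpace Ω] (P : Measure Ω) [IsProbabilityMeasure P] (X : ℕ → Ω → ℝ)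
      (y₀ M' δ' : ℝ),
      (∀ j, Measurable (X j)) → (∀ j ω, 0 ≤ X j ω) → 0 < y₀ → 0 ≤ M' → 0 ≤ δ' →
      (∀ m : ℕ, ∀ S : Finset (Fin K), S.Nonempty →
        P {ω | ∀ j ∈ S, y₀ * 2 ^ m < X j ω} ≤ ENNReal.ofReal (Real.exp (-((c₀ + 2 * m) * S.card)))) →
      (∀ j, j < K → ∫⁻ ω, ENNReal.ofReal (max (X j ω - M') 0) ∂P ≤ ENNReal.ofReal δ') →
      ∫⁻ ω, ENNReal.ofReal (Set.indicator {y : ℝ | 8 * y₀ < y} (fun y => y)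
          ((K : ℝ)⁻¹ * ∑ j ∈ Finset.range K, X j ω)) ∂P ≤ ENNReal.ofReal (M' * η + δ')

/-- **Card 2's transfer**: `C⁺ := ∃ τ₁ y₀ c₀, HeavyBlockPatternCost ∧ OneBlockUI` (plus the engine and the block
identity) `⟹` the crux. -/
def PatternCostTransfer : Prop :=
  PatternCostEngine →
  (∃ τ₁ y₀ c₀ : ℝ, 0 < τ₁ ∧ 0 < y₀ ∧ 3 ≤ c₀ ∧ HeavyBlockPatternCost τ₁ y₀ c₀ ∧ OneBlockUI τ₁) →
    Summit.AtomisticToContinuum.HydrodynamicLimit.Theses.TwoClocks.TransferActivityTails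

/-! ## Sanity: the statements are inhabited-in-kind (trivial instances elaborate) -/

example : blockLen 1 0 = 1 := by simp [blockLen]

end Summit.AtomisticToContinuum.HydrodynamicLimit.Cruxes.TransferActivityTails.IdeatorFive

end
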